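import Summits.ResolutionOfSingularities.ResolutionOfSingularities.Theorems.FrobeniusLadderFInjectiveMacaulayficationOfFactsClosedCentre
import Summits.ResolutionOfSingularities.ResolutionOfSingularities.Theorems.FrobeniusLadderFInjectiveMacaulayficationCurveStageProducer
import Summits.ResolutionOfSingularities.ResolutionOfSingularities.Theorems.FrobeniusLadderFInjectiveMacaulayficationFiLocusOpenOfAffine
import Literature.AlgebraicGeometry.Resolution.MacaulayficationKawasakiHolds
import Summits.ResolutionOfSingularities.ResolutionOfSingularities.Theorems.FrobeniusLadderFInjectiveMacaulayficationFCUnguarded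
import HarnessLib

/-!
# THE v30 DOOR KERNEL (lead-1 gen 5; plan-1 R13.33 (2)/(4), ADOPTED as v30-ELECT by R13.35): crux ⇐ Datta–Murayama ∧ #4β (closed centre, Z-supported currency) ∧ FC″
# (the UNGUARDED fibre condition) — NO use of 5e `stub_h4Loc`
# (crux `FInjectiveMacaulayfication` stmt-ResolutionOfSingularities-15315, chain w45a; strat-1 `H4LOC-KILL-WILDPINCH.md` e222be87e80efea5 §6 R1)

[OURS · L1 W4.5a · res-L1-w45a-lead-1 gen 5] Support file (`--supports stmt-ResolutionOfSingularities-15315 --as helper`); NOT a statement of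
any manuscript; AI-written, weaker than expert review.

If 5e dies at wild pinch points (strat-1's Theorem W, refereeing), the v29 chain `DM ∧ 5e ∧ FC′ ⇒ crux` is cut at BOTH places where 5e
enters (closed stage: `DoorOfClass.…_of_h4Loc_named`; non-closed stage: `GenericFibreReduction.pfixGen_of_h4Loc`). This file shows the chain
re-proves with ONE file and NO 5e: (1) `closedLocusStrongPlusStep_of_fcUnguarded`: #3β ⇐ FC″, where FC″ is `GenericFibreReduction.FCForallExists`
with its ∀c-GUARD DROPPED (the LocFix datum `c′` of currency (A′) — `(c′) ≤ 𝔪_η`, no radical condition — is produced by FC″ itself and fed to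
the tree's §C3 `CurveStageProducer.closedLocusStep_of_locFix_of_fc`, which already accepts non-primary centres); (2)
`fInjectiveMacaulayfication_of_closedCentre_of_fcUnguarded`: crux ⇐ DM ∧ #4β ∧ FC″ through the TREE door
`OfFactsClosedCentre.fInjectiveMacaulayfication_of_closedCentre_schemeOpen` (v22–v26; Kawasaki = `kawasakiMacaulayfication_holds` by name,
#2 = DM through `FiLocusOpenOfAffine.fiLocusOpen_of_ringLevel`), whose closed-point input #4β («∃ J ≠ ⊥, b ∈ supp J, every blow-up along J
FULL at EVERY point over supp J») is the Z-supported currency that survives Theorem W (c′ = 𝓘_D at the wild pinch). 5e ⇒ #4β pointwise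
(`ClosedCentreOfH4Loc`, p512968) keeps every PFix specimen theorem a producer of #4β instances. No definitions (FC″ enters BY NAME as `GenericFibreReduction.FCUnguarded`, res-L1-w45a-stub-3's file of strat-1's §0 text), no named facts beyond the door's. [folklore glue]
-/

-- single-problem summit: the doubled namespace component is forced
set_option linter.dupNamespace false

noncomputable section

open AlgebraicGeometry CategoryTheory Literature.AlgebraicGeometry.Resolution TopologicalSpace IsLocalRing

namespace Summit.ResolutionOfSingularities.ResolutionOfSingularities.Theorems.FInjectiveMacaulayfication.DoorUnguarded

open Summit.ResolutionOfSingularities.ResolutionOfSingularities.Theorems.FInjectiveMacaulayfication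

/-- **#3β ⇐ FC″ (the unguarded fibre condition)**: for every admissible `(X₁,f₁)` and every non-closed maximal bad point `η`, FC″ hands a
pair `(J, c′)` — `J ≠ ⊥` with `η ∈ supp J`, `c′` a LocFix datum at `η` in currency (A′) with `stalkIdeal J η = (c′)`, (nc)/(cl) for every
blow-up along `J` — and §C3 `CurveStageProducer.closedLocusStep_of_locFix_of_fc` turns it into the closed-locus STRONG⁺ step. [folklore] -/
theorem closedLocusStrongPlusStep_of_fcUnguarded
    (hFCu : Summit.ResolutionOfSingularities.ResolutionOfSingularities.Theorems.FInjectiveMacaulayfication.GenericFibreReduction.FCUnguarded) :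
    ∀ (p : ℕ), p.Prime → ∀ (k : Type) [Field k] [CharP k p] (X₁ : Scheme.{0}) (f₁ : X₁ ⟶ Spec (.of k)),
          IsSeparated f₁ → LocallyOfFiniteType f₁ → QuasiCompact f₁ → IsIntegral X₁ →
          (∀ x : X₁, (∀ d : ℕ, ringKrullDim (X₁.presheaf.stalk x) = d → ∀ s : Fin d → X₁.presheaf.stalk x, (Ideal.span (Set.range s)).radical.IsMaximal → RingTheory.Sequence.IsWeaklyRegular (X₁.presheaf.stalk x) (List.ofFn s))) →
          ∀ η : X₁, (¬ IsClosed ({η} : Set X₁) ∧ ¬ (∀ d : ℕ, ringKrullDim (X₁.presheaf.stalk η) = d → ∀ s : Fin d → X₁.presheaf.stalk η, (Ideal.span (Set.range s)).radical.IsMaximal → ∀ t : X₁.presheaf.stalk η, (∃ e : ℕ, t ^ p ^ e ∈ Ideal.span ((fun z : X₁.presheaf.stalk η => z ^ p ^ e) '' (Ideal.span (Set.range s) : Set (X₁.presheaf.stalk η)))) → t ∈ Ideal.span (Set.range s)) ∧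
            ∀ y : X₁, y ⤳ η → y ≠ η → (∀ d : ℕ, ringKrullDim (X₁.presheaf.stalk y) = d → ∀ s : Fin d → X₁.presheaf.stalk y, (Ideal.span (Set.range s)).radical.IsMaximal → ∀ t : X₁.presheaf.stalk y, (∃ e : ℕ, t ^ p ^ e ∈ Ideal.span ((fun z : X₁.presheaf.stalk y => z ^ p ^ e) '' (Ideal.span (Set.range s) : Set (X₁.presheaf.stalk y)))) → t ∈ Ideal.span (Set.range s))) →
            ∃ (X₂ : Scheme.{0}) (π : X₂ ⟶ X₁), IsProper π ∧ Literature.AlgebraicGeometry.Resolution.IsBirational π ∧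
              IsIntegral X₂ ∧ (∀ x : X₂, (∀ d : ℕ, ringKrullDim (X₂.presheaf.stalk x) = d → ∀ s : Fin d → X₂.presheaf.stalk x, (Ideal.span (Set.range s)).radical.IsMaximal → RingTheory.Sequence.IsWeaklyRegular (X₂.presheaf.stalk x) (List.ofFn s))) ∧
              ∃ (Z : Set X₁) (hZ : IsClosed Z), η ∈ Z ∧ IsIso (π ∣_ ⟨Zᶜ, hZ.isOpen_compl⟩) ∧
              ∀ x : X₂, π.base x ∈ Z → ¬ IsClosed ({x} : Set X₂) → (IsDomain (X₂.presheaf.stalk x) ∧ ∀ d : ℕ, ringKrullDim (X₂.presheaf.stalk x) = d → ∀ s : Fin d → X₂.presheaf.stalk x, (Ideal.span (Set.range s)).radical.IsMaximal → RingTheory.Sequence.IsWeaklyRegular (X₂.presheaf.stalk x) (List.ofFn s) ∧ ∀ t : X₂.presheaf.stalk x, (∃ e : ℕ, t ^ p ^ e ∈ Ideal.span ((fun z : X₂.presheaf.stalk x => z ^ p ^ e) '' (Ideal.span (Set.range s) : Set (X₂.presheaf.stalk x)))) → t ∈ Ideal.span (Set.range s)) := by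
  intro p hp k _ _ X₁ f₁ hsep hft hqc hint hCM η hη
  obtain ⟨J, n', c', hJ0, hηJ, hc0, hcm, hgood, hJη, hfc⟩ := hFCu p hp k X₁ f₁ hsep hft hqc hint hCM η hη
  exact CurveStageProducer.closedLocusStep_of_locFix_of_fc p hp k X₁ f₁ hsep hft hqc hint hCM η hη n' c' hc0 hcm hgood J hJ0 hηJ hJη hfc

/-- **THE v30 DOOR KERNEL: crux ⇐ Datta–Murayama (named fact, BY NAME) ∧ #4β (closed centre, Z-supported currency) ∧ FC″ (unguarded).**
Kawasaki is the Literature theorem `kawasakiMacaulayfication_holds`; no 5e. [folklore] -/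
theorem fInjectiveMacaulayfication_of_closedCentre_of_fcUnguarded
    (hDM : Literature.AlgebraicGeometry.Resolution.DattaMurayama2024_fInjectiveLocusOpen.{0})
    (h4β : ∀ (p : ℕ), p.Prime → ∀ (k : Type) [Field k] [CharP k p] (X₁ : Scheme.{0}) (f₁ : X₁ ⟶ Spec (.of k)),
        IsSeparated f₁ → LocallyOfFiniteType f₁ → QuasiCompact f₁ → IsIntegral X₁ →
        (∀ x : X₁, ∀ d : ℕ, ringKrullDim (X₁.presheaf.stalk x) = d → ∀ s : Fin d → X₁.presheaf.stalk x, (Ideal.span (Set.range s)).radical.IsMaximal → RingTheory.Sequence.IsWeaklyRegular (X₁.presheaf.stalk x) (List.ofFn s)) →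
        Set.Finite {x : X₁ | ¬ ∀ d : ℕ, ringKrullDim (X₁.presheaf.stalk x) = d → ∀ s : Fin d → X₁.presheaf.stalk x, (Ideal.span (Set.range s)).radical.IsMaximal → ∀ y : X₁.presheaf.stalk x, (∃ e : ℕ, y ^ p ^ e ∈ Ideal.span ((fun z : X₁.presheaf.stalk x => z ^ p ^ e) '' (Ideal.span (Set.range s) : Set (X₁.presheaf.stalk x)))) → y ∈ Ideal.span (Set.range s)} →
        ∀ b : X₁, IsClosed ({b} : Set X₁) → (¬ ∀ d : ℕ, ringKrullDim (X₁.presheaf.stalk b) = d → ∀ s : Fin d → X₁.presheaf.stalk b, (Ideal.span (Set.range s)).radical.IsMaximal → ∀ y : X₁.presheaf.stalk b, (∃ e : ℕ, y ^ p ^ e ∈ Ideal.span ((fun z : X₁.presheaf.stalk b => z ^ p ^ e) '' (Ideal.span (Set.range s) : Set (X₁.presheaf.stalk b)))) → y ∈ Ideal.span (Set.range s)) →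
        ∃ J : X₁.IdealSheafData, J ≠ ⊥ ∧ b ∈ (J.support : Set X₁) ∧
          ∀ (X' : Scheme.{0}) (π : X' ⟶ X₁), Literature.AlgebraicGeometry.Resolution.IsBlowup π J →
            ∀ x' : X', π.base x' ∈ (J.support : Set X₁) → IsDomain (X'.presheaf.stalk x') ∧ ∀ d : ℕ, ringKrullDim (X'.presheaf.stalk x') = d → ∀ s : Fin d → X'.presheaf.stalk x', (Ideal.span (Set.range s)).radical.IsMaximal → RingTheory.Sequence.IsWeaklyRegular (X'.presheaf.stalk x') (List.ofFn s) ∧ ∀ y : X'.presheaf.stalk x', (∃ e : ℕ, y ^ p ^ e ∈ Ideal.span ((fun z : X'.presheaf.stalk x' => z ^ p ^ e) '' (Ideal.span (Set.range s) : Set (X'.presheaf.stalk x')))) → y ∈ Ideal.span (Set.range s))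
    (hFCu : Summit.ResolutionOfSingularities.ResolutionOfSingularities.Theorems.FInjectiveMacaulayfication.GenericFibreReduction.FCUnguarded) :
    Summit.ResolutionOfSingularities.ResolutionOfSingularities.Theses.FrobeniusLadder.FInjectiveMacaulayfication :=
  OfFactsClosedCentre.fInjectiveMacaulayfication_of_closedCentre_schemeOpen
    Literature.AlgebraicGeometry.Resolution.kawasakiMacaulayfication_holds
    (fun p hp k _ _ X₁ f₁ hft hCM => FiLocusOpenOfAffine.fiLocusOpen_of_ringLevel p k (hDM p hp k) X₁ f₁ hft hCM)
    (closedLocusStrongPlusStep_of_fcUnguarded hFCu) h4β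

end Summit.ResolutionOfSingularities.ResolutionOfSingularities.Theorems.FInjectiveMacaulayfication.DoorUnguarded

end
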